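import Mathlib.Analysis.InnerProductSpace.LinearMap
import Mathlib.Analysis.SpecialFunctions.Trigonometric.Bounds
import Mathlib.Algebra.Order.BigOperators.Ring.Finset
import HarnessLib

/-!
# BalabanUVNodes ∕ N15 — THE KING-MODEL RUNG (PART Ϳ-a): THE TWISTED 4-CYCLE LEMMA — a plaquette whose holonomy `W` is uniformly non-flat (`Re⟪u,Wu⟫ ≤ γ‖u‖²`) carries the
# covariant Dirichlet energy `‖a−b₁‖² + ‖b₁−b₂‖² + ‖b₂−b₃‖² + ‖b₃−Wa‖² ≥ λ(γ)·(‖a‖²+‖b₁‖²+‖b₂‖²+‖b₃‖²)`, `λ(γ) = 2 − √(2+√(2+2γ))` (`= 2−2cos(θ∕4)` at `γ = cos θ`)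
# (Track A, DAG node N15 = NE2; FAN-OUT v1.1 §N15 s3 «KING-MODEL RUNG … + what the curved case adds»; count-neutral)

HONEST FRAMING.  Count-neutral (cell `pub-ymgap`, seat `pub-ymgap-dag-n15-e` g46; `--supports stmt-QuantumFields-27247 --as helper` = K3ᴬ, KEY MAP v3).  An elementary inequality in an
arbitrary inner product space; the comparison object of PART Ϳ is King's `A = 0` fine covariance; nothing of Bałaban's (3.42) is asserted; nothing continuum ∕ ℝ⁴ ∕ OS ∕ Clay; NOT a node
discharge (N15 of record untouched).

THE POINT OF PART Ϳ («CURVATURE AS MASS»).  PARTS Ͱ–Ͻ decided King's fine covariance `(−cΔ_U+m²)⁻¹` at every unitary `U` by DOMINATION (sizes never grow) and, exactly, on the FLAT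
sector (torons, finite covers), leaving the honest boundary «constant flux: no cover trivialises curvature» (Ͻ-q `fluxLink_not_trivialised`).  PART Ϳ attacks curvature head-on with a
LOCAL, QUANTITATIVE, NON-ABELIAN form of the diamagnetic inequality: [DodziukMathai2006] Cor 1.3 `λ₀(Δ) ≤ λ₀(Δ_σ)` and PART Ͱ-d's «`−cΔ_U` positive definite iff `U` is not a pure
gauge» become «curvature bounded BELOW opens a MASS»: if the plaquette holonomies are uniformly non-flat, `−cΔ_U ≥ (const)·c` (Ϳ-b), sharp at π-flux (Ϳ-d).  THIS FILE is the
one-plaquette engine, in an arbitrary inner product space `E` over `𝕜 = ℝ, ℂ` (no lattice yet):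
* §1 `plaqGap γ := 2 − √(2 + √(2+2γ))` and its calculus: `plaqGap_one = 0` (flat), `plaqGap_neg_one = 2 − √2` (π-flux), `plaqGap_nonneg` (`γ ≤ 1`), `plaqGap_antitone`, `plaqGap_le_two`,
  ★ `plaqGap_cos` (`plaqGap (cos θ) = 2 − 2cos(θ∕4)` for `|θ| ≤ π` — the bottom `2−2cos((θ+2πk)∕4)|_{k=0}` of the 4-cycle with flux `θ`), `plaqGap_cos_le_sq` (`≤ θ²∕16`),
  ★ `plaqGap_cos_ge_sq` (`≥ θ²∕(4π²)`, Jordan);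
* §2 ★★★ **`twisted_cycle_four_ge`** — for a linear isometry `W` of `E` with `Re⟪u, Wu⟫ ≤ γ‖u‖²` (numerical range of the holonomy in the half-plane `Re ≤ γ`):
  `plaqGap γ·(‖a‖²+‖b₁‖²+‖b₂‖²+‖b₃‖²) ≤ ‖a−b₁‖²+‖b₁−b₂‖²+‖b₂−b₃‖²+‖b₃−Wa‖²`.  PROOF WITHOUT DIAGONALISING `W`: with `N = Σ‖·‖²` and `S = Re(⟪a,b₁⟫+⟪b₁,b₂⟫+⟪b₂,b₃⟫+⟪b₃,Wa⟫)` the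
  energy is `2N − 2S`; `2S = Re(⟪Wa,Wb₁+b₃⟫+⟪b₁,a+b₂⟫+⟪b₂,b₁+b₃⟫+⟪b₃,b₂+Wa⟫)` (the adjacency operator `A_W` of the twisted cycle), Cauchy–Schwarz gives `(2S)² ≤ N·Σ‖u_i‖²`, and
  `Σ‖u_i‖² = 2N + 2Re(⟪(1+W)b₁,b₃⟫+⟪b₂,(1+W)a⟫) ≤ (2+√(2+2γ))N` because `‖(1+W)u‖² = 2‖u‖²+2Re⟪u,Wu⟫ ≤ (2+2γ)‖u‖²` — i.e. `A_W² = 2 + B`, `‖B‖ ≤ 2cos(θ∕2)`, `‖A_W‖ ≤ 2cos(θ∕4)`;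
  ★★ `twisted_cycle_four_ge_links` — the same for FOUR unitary links `W₀₁,W₁₂,W₂₃,W₃₀` with holonomy `W = W₀₁W₁₂W₂₃W₃₀` (gauge-fixing `b₁ = W₀₁a₁, b₂ = W₀₁W₁₂a₂, b₃ = W₀₁W₁₂W₂₃a₃`):
  `plaqGap γ·Σ_i‖a_i‖² ≤ ‖a₀−W₀₁a₁‖²+‖a₁−W₁₂a₂‖²+‖a₂−W₂₃a₃‖²+‖a₃−W₃₀a₀‖²` — the form Ϳ-b sums over the plaquettes of King's torus;
* §3 the scalar (U(1)) reading: for `W = ` multiplication by a unit scalar `w`, `Re⟪u,Wu⟫ = Re w·‖u‖²` (`re_inner_smul_unit`), so `γ = Re w = cos(arg w)`.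
WHAT THE CURVED CASE ADDS (as theorems, this file): a flat plaquette (`γ = 1`) contributes nothing (`plaqGap_one`), a non-flat one contributes `2−2cos(θ∕4) ≥ θ²∕(4π²)` per unit of mass on its
corners; the maximum `2−√2` is reached at holonomy `−1`.  PRIOR TREE ART (by name, not restated): Mathlib (`LinearIsometry.inner_map_map`, `norm_sub_sq`, `norm_add_sq`, `re_inner_le_norm`,
`Finset.sum_mul_sq_le_sq_mul_sq`, `Real.cos_sq`, `Real.mul_le_sin`, `Real.one_sub_sq_div_two_le_cos`).  Dedup (rg at filing): basename 0 files; needles `plaqGap|twisted_cycle_four` 0 tree files.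
Locators: [DodziukMathai2006] §1 Lemma 1.2 ∕ Cor 1.3 (Kato's inequality and `λ₀(Δ) ≤ λ₀(Δ_σ)` for discrete magnetic Laplacians); [Balaban1985BackgroundPropagators] (3.3) p.391 (covariant
difference), (3.23) p.394 (`Δ_U = D*_UD_U`); [King1986] (2.12) p.653 (plaquette variables), (4.4) p.670 (the fine operator).  0 `sorry`, 1 `def`.
-/

noncomputable section
open scoped BigOperators ComplexConjugate InnerProductSpace
open Finset

namespace Summit.QuantumFields.YangMills.BalabanUVNodes.N15KingModelRung.Curvature

/-! ## §1 The plaquette gap function `λ(γ) = 2 − √(2 + √(2+2γ))` -/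

section Gap

/-- THE PLAQUETTE GAP FUNCTION `λ(γ) = 2 − √(2 + √(2 + 2γ))`: the bottom of the Dirichlet spectrum of a 4-cycle whose holonomy has numerical range in `Re ≤ γ` (`λ(cos θ) = 2 − 2cos(θ∕4)`).
[cite: DodziukMathai2006, Cor 1.3 §1] -/
def plaqGap (γ : ℝ) : ℝ := 2 - Real.sqrt (2 + Real.sqrt (2 + 2 * γ))

/-- A FLAT plaquette has no gap: `λ(1) = 2 − √(2+√4) = 0`. [folklore] -/
theorem plaqGap_one : plaqGap 1 = 0 := by
  have h4 : Real.sqrt (2 + 2 * 1) = 2 := by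
    rw [show (2 : ℝ) + 2 * 1 = 2 ^ 2 by norm_num, Real.sqrt_sq (by norm_num)]
  rw [plaqGap, h4, show (2 : ℝ) + 2 = 2 ^ 2 by norm_num, Real.sqrt_sq (by norm_num), sub_self]

/-- The π-FLUX value: `λ(−1) = 2 − √2`. [folklore] -/
theorem plaqGap_neg_one : plaqGap (-1) = 2 - Real.sqrt 2 := by
  rw [plaqGap, show (2 : ℝ) + 2 * (-1) = 0 by norm_num, Real.sqrt_zero, add_zero]

/-- `λ(γ) ≤ 2` always. [folklore] -/
theorem plaqGap_le_two (γ : ℝ) : plaqGap γ ≤ 2 := by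
  unfold plaqGap
  linarith [Real.sqrt_nonneg (2 + Real.sqrt (2 + 2 * γ))]

/-- `λ` is ANTITONE: a flatter plaquette (larger `γ`) has a smaller gap. [folklore] -/
theorem plaqGap_antitone {γ₁ γ₂ : ℝ} (h : γ₁ ≤ γ₂) : plaqGap γ₂ ≤ plaqGap γ₁ := by
  unfold plaqGap
  have h1 : Real.sqrt (2 + 2 * γ₁) ≤ Real.sqrt (2 + 2 * γ₂) := Real.sqrt_le_sqrt (by linarith)
  have h2 : Real.sqrt (2 + Real.sqrt (2 + 2 * γ₁)) ≤ Real.sqrt (2 + Real.sqrt (2 + 2 * γ₂)) := Real.sqrt_le_sqrt (by linarith)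
  linarith

/-- `λ(γ) ≥ 0` for `γ ≤ 1` (the numerical range of a unitary never exceeds `Re = 1`). [folklore] -/
theorem plaqGap_nonneg {γ : ℝ} (h : γ ≤ 1) : 0 ≤ plaqGap γ := by
  rw [← plaqGap_one]
  exact plaqGap_antitone h

/-- `λ(−1) ≤ λ(γ)` is the largest value on `[−1, 1]`: `λ(γ) ≤ 2 − √2`. [folklore] -/
theorem plaqGap_le_neg_one {γ : ℝ} (h : -1 ≤ γ) : plaqGap γ ≤ 2 - Real.sqrt 2 := by
  rw [← plaqGap_neg_one]
  exact plaqGap_antitone h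

/-- ★ THE TRIGONOMETRIC READING: `λ(cos θ) = 2 − 2cos(θ∕4)` for `|θ| ≤ π` — the smallest eigenvalue `2 − 2cos((θ+2πk)∕4)` (`k = 0`) of the 4-cycle with flux `θ` (two half-angle steps:
`√(2+2cos θ) = 2cos(θ∕2)`, `√(2+2cos(θ∕2)) = 2cos(θ∕4)`). [cite: DodziukMathai2006, Cor 1.3 §1] -/
theorem plaqGap_cos {θ : ℝ} (hθ : |θ| ≤ Real.pi) : plaqGap (Real.cos θ) = 2 - 2 * Real.cos (θ / 4) := by
  have hθ2 : |θ / 2| ≤ Real.pi / 2 := by rw [abs_div, abs_two]; linarith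
  have hθ4 : |θ / 4| ≤ Real.pi / 2 := by
    rw [abs_div, show |(4 : ℝ)| = 4 from abs_of_pos (by norm_num)]; linarith [Real.pi_pos]
  have hc2 : 0 ≤ Real.cos (θ / 2) := Real.cos_nonneg_of_neg_pi_div_two_le_of_le (by linarith [abs_le.mp hθ2]) (abs_le.mp hθ2).2
  have hc4 : 0 ≤ Real.cos (θ / 4) := Real.cos_nonneg_of_neg_pi_div_two_le_of_le (by linarith [abs_le.mp hθ4]) (abs_le.mp hθ4).2
  have h1 : Real.sqrt (2 + 2 * Real.cos θ) = 2 * Real.cos (θ / 2) := by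
    have : 2 + 2 * Real.cos θ = (2 * Real.cos (θ / 2)) ^ 2 := by
      rw [mul_pow, Real.cos_sq (θ / 2), show 2 * (θ / 2) = θ by ring]; ring
    rw [this, Real.sqrt_sq (by positivity)]
  have h2 : Real.sqrt (2 + 2 * Real.cos (θ / 2)) = 2 * Real.cos (θ / 4) := by
    have : 2 + 2 * Real.cos (θ / 2) = (2 * Real.cos (θ / 4)) ^ 2 := by
      rw [mul_pow, Real.cos_sq (θ / 4), show 2 * (θ / 4) = θ / 2 by ring]; ring
    rw [this, Real.sqrt_sq (by positivity)]
  rw [plaqGap, h1, h2]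

/-- `λ(cos θ) ≤ θ²∕16` (`1 − cos t ≤ t²∕2`): small curvature gives a small gap — in Bałaban's regular regime (plaquettes within `O(η²)` of `1`) the plaquette gap is `O(η⁴)` in lattice units, no uniform
mass; PART Ϳ is about the opposite, strongly curved, regime. [folklore] -/
theorem plaqGap_cos_le_sq {θ : ℝ} (hθ : |θ| ≤ Real.pi) : plaqGap (Real.cos θ) ≤ θ ^ 2 / 16 := by
  rw [plaqGap_cos hθ]
  have h := Real.one_sub_sq_div_two_le_cos (x := θ / 4)
  nlinarith [h]

/-- ★ `λ(cos θ) ≥ θ²∕(4π²)` for `|θ| ≤ π` (Jordan: `1 − cos t = 2sin²(t∕2) ≥ 2(2∕π·t∕2)²`): a plaquette angle `θ` yields at least `θ²∕(4π²)` of gap. [folklore] -/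
theorem plaqGap_cos_ge_sq {θ : ℝ} (hθ : |θ| ≤ Real.pi) : θ ^ 2 / (4 * Real.pi ^ 2) ≤ plaqGap (Real.cos θ) := by
  rw [plaqGap_cos hθ]
  -- `2 − 2cos(θ/4) = 4 sin²(θ/8)` and `|sin(θ/8)| ≥ (2/π)|θ|/8`
  have hsq : 2 - 2 * Real.cos (θ / 4) = 4 * Real.sin (θ / 8) ^ 2 := by
    rw [Real.sin_sq, Real.cos_sq (θ / 8), show 2 * (θ / 8) = θ / 4 by ring]; ring
  rw [hsq]
  have hpi := Real.pi_pos
  have h8 : |θ| / 8 ≤ Real.pi / 2 := by linarith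
  have hsin : 2 / Real.pi * (|θ| / 8) ≤ Real.sin (|θ| / 8) := Real.mul_le_sin (by positivity) h8
  have habs : Real.sin (|θ| / 8) ^ 2 = Real.sin (θ / 8) ^ 2 := by
    rcases le_or_gt 0 θ with h | h
    · rw [abs_of_nonneg h]
    · rw [abs_of_neg h, show -θ / 8 = -(θ / 8) by ring, Real.sin_neg, neg_sq]
  have hl : 0 ≤ 2 / Real.pi * (|θ| / 8) := by positivity
  have h2 : (2 / Real.pi * (|θ| / 8)) ^ 2 ≤ Real.sin (|θ| / 8) ^ 2 := pow_le_pow_left₀ hl hsin 2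
  rw [← habs]
  have h3 : (2 / Real.pi * (|θ| / 8)) ^ 2 = θ ^ 2 / (16 * Real.pi ^ 2) := by
    rw [mul_pow, div_pow, div_pow, sq_abs]; field_simp; ring
  rw [h3] at h2
  have h4 : θ ^ 2 / (4 * Real.pi ^ 2) = 4 * (θ ^ 2 / (16 * Real.pi ^ 2)) := by field_simp; ring
  rw [h4]
  linarith

end Gap

/-! ## §2 The twisted 4-cycle -/

section Cycle

variable {𝕜 : Type*} [RCLike 𝕜] {E : Type*} [NormedAddCommGroup E] [InnerProductSpace 𝕜 E]

/-- `‖(1+W)u‖² ≤ (2+2γ)‖u‖²` for an isometry with `Re⟪u,Wu⟫ ≤ γ‖u‖²`. [folklore] -/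
theorem norm_add_isometry_sq_le (W : E →ₗᵢ[𝕜] E) {γ : ℝ} (hγ : ∀ u, RCLike.re ⟪u, W u⟫_𝕜 ≤ γ * ‖u‖ ^ 2) (u : E) :
    ‖u + W u‖ ^ 2 ≤ (2 + 2 * γ) * ‖u‖ ^ 2 := by
  rw [@norm_add_sq 𝕜, W.norm_map]
  nlinarith [hγ u]

/-- `Re⟪u,Wu⟫ ≥ −‖u‖²` for an isometry, so the hypothesis forces `(2+2γ)‖u‖² ≥ 0`. [folklore] -/
theorem two_add_two_mul_nonneg_of (W : E →ₗᵢ[𝕜] E) {γ : ℝ} (hγ : ∀ u, RCLike.re ⟪u, W u⟫_𝕜 ≤ γ * ‖u‖ ^ 2) (u : E) :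
    0 ≤ (2 + 2 * γ) * ‖u‖ ^ 2 :=
  (sq_nonneg ‖u + W u‖).trans (norm_add_isometry_sq_le W hγ u)

/-- `‖(1+W)u‖ ≤ √(2+2γ)·‖u‖`. [folklore] -/
theorem norm_add_isometry_le (W : E →ₗᵢ[𝕜] E) {γ : ℝ} (hγ : ∀ u, RCLike.re ⟪u, W u⟫_𝕜 ≤ γ * ‖u‖ ^ 2) (u : E) :
    ‖u + W u‖ ≤ Real.sqrt (2 + 2 * γ) * ‖u‖ := by
  have h := norm_add_isometry_sq_le W hγ u
  by_cases hu : u = 0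
  · simp [hu]
  · have hpos : 0 < ‖u‖ ^ 2 := by positivity
    have h22 : 0 ≤ 2 + 2 * γ := nonneg_of_mul_nonneg_left (two_add_two_mul_nonneg_of W hγ u) hpos
    calc ‖u + W u‖ = Real.sqrt (‖u + W u‖ ^ 2) := (Real.sqrt_sq (norm_nonneg _)).symm
      _ ≤ Real.sqrt ((2 + 2 * γ) * ‖u‖ ^ 2) := Real.sqrt_le_sqrt h
      _ = Real.sqrt (2 + 2 * γ) * ‖u‖ := by rw [Real.sqrt_mul h22, Real.sqrt_sq (norm_nonneg _)]
set_option maxHeartbeats 400000 in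
/-- ★★★ **THE TWISTED 4-CYCLE LEMMA**: for a linear isometry `W` of an inner product space with `Re⟪u, Wu⟫ ≤ γ‖u‖²` for all `u` (a holonomy whose numerical range lies in `Re ≤ γ`),
`λ(γ)·(‖a‖²+‖b₁‖²+‖b₂‖²+‖b₃‖²) ≤ ‖a−b₁‖² + ‖b₁−b₂‖² + ‖b₂−b₃‖² + ‖b₃−Wa‖²`, `λ(γ) = 2 − √(2+√(2+2γ))` — the Dirichlet energy of a 4-cycle closed through `W` is coercive as soon as
`W` is uniformly non-flat; proved by Cauchy–Schwarz on the square of the cycle's adjacency (`A_W² = 2 + B`, `‖B‖ ≤ √(2+2γ)`), no spectral theorem. [cite: DodziukMathai2006, Cor 1.3 §1] -/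
theorem twisted_cycle_four_ge (W : E →ₗᵢ[𝕜] E) {γ : ℝ} (hγ : ∀ u, RCLike.re ⟪u, W u⟫_𝕜 ≤ γ * ‖u‖ ^ 2) (a b₁ b₂ b₃ : E) :
    plaqGap γ * (‖a‖ ^ 2 + ‖b₁‖ ^ 2 + ‖b₂‖ ^ 2 + ‖b₃‖ ^ 2)
      ≤ ‖a - b₁‖ ^ 2 + ‖b₁ - b₂‖ ^ 2 + ‖b₂ - b₃‖ ^ 2 + ‖b₃ - W a‖ ^ 2 := by
  -- abbreviations (plain reals)
  have hρ0 : 0 ≤ Real.sqrt (2 + 2 * γ) := Real.sqrt_nonneg _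
  have hN0 : 0 ≤ ‖a‖ ^ 2 + ‖b₁‖ ^ 2 + ‖b₂‖ ^ 2 + ‖b₃‖ ^ 2 := by positivity
  -- symmetry of real parts
  have e1 : RCLike.re ⟪W a, b₃⟫_𝕜 = RCLike.re ⟪b₃, W a⟫_𝕜 := by rw [← inner_conj_symm, RCLike.conj_re]
  have e2 : RCLike.re ⟪b₁, a⟫_𝕜 = RCLike.re ⟪a, b₁⟫_𝕜 := by rw [← inner_conj_symm, RCLike.conj_re]
  have e3 : RCLike.re ⟪b₂, b₁⟫_𝕜 = RCLike.re ⟪b₁, b₂⟫_𝕜 := by rw [← inner_conj_symm, RCLike.conj_re]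
  have e4 : RCLike.re ⟪b₃, b₂⟫_𝕜 = RCLike.re ⟪b₂, b₃⟫_𝕜 := by rw [← inner_conj_symm, RCLike.conj_re]
  have e5 : RCLike.re ⟪b₂, a⟫_𝕜 = RCLike.re ⟪a, b₂⟫_𝕜 := by rw [← inner_conj_symm, RCLike.conj_re]
  -- the energy is `2N − 2S`
  have hF : ‖a - b₁‖ ^ 2 + ‖b₁ - b₂‖ ^ 2 + ‖b₂ - b₃‖ ^ 2 + ‖b₃ - W a‖ ^ 2
      = 2 * (‖a‖ ^ 2 + ‖b₁‖ ^ 2 + ‖b₂‖ ^ 2 + ‖b₃‖ ^ 2)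
        - 2 * (RCLike.re ⟪a, b₁⟫_𝕜 + RCLike.re ⟪b₁, b₂⟫_𝕜 + RCLike.re ⟪b₂, b₃⟫_𝕜 + RCLike.re ⟪b₃, W a⟫_𝕜) := by
    rw [@norm_sub_sq 𝕜, @norm_sub_sq 𝕜, @norm_sub_sq 𝕜, @norm_sub_sq 𝕜, W.norm_map]; ring
  -- `2S` through the four adjacency vectors `u₀ = Wb₁+b₃`, `u₁ = a+b₂`, `u₂ = b₁+b₃`, `u₃ = b₂+Wa`
  have h2S : 2 * (RCLike.re ⟪a, b₁⟫_𝕜 + RCLike.re ⟪b₁, b₂⟫_𝕜 + RCLike.re ⟪b₂, b₃⟫_𝕜 + RCLike.re ⟪b₃, W a⟫_𝕜)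
      = RCLike.re ⟪W a, W b₁ + b₃⟫_𝕜 + RCLike.re ⟪b₁, a + b₂⟫_𝕜 + RCLike.re ⟪b₂, b₁ + b₃⟫_𝕜 + RCLike.re ⟪b₃, b₂ + W a⟫_𝕜 := by
    simp only [inner_add_right, map_add, W.inner_map_map]
    rw [e1, e2, e3, e4]; ring
  -- Cauchy–Schwarz: `|2S| ≤ Σ‖w_i‖‖u_i‖` and `(Σ‖w_i‖‖u_i‖)² ≤ N·U`
  have hcs := Finset.sum_mul_sq_le_sq_mul_sq Finset.univ (![‖a‖, ‖b₁‖, ‖b₂‖, ‖b₃‖]) (![‖W b₁ + b₃‖, ‖a + b₂‖, ‖b₁ + b₃‖, ‖b₂ + W a‖])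
  simp only [Fin.sum_univ_four, Matrix.cons_val_zero, Matrix.cons_val_one, Matrix.cons_val] at hcs
  have hle : 2 * (RCLike.re ⟪a, b₁⟫_𝕜 + RCLike.re ⟪b₁, b₂⟫_𝕜 + RCLike.re ⟪b₂, b₃⟫_𝕜 + RCLike.re ⟪b₃, W a⟫_𝕜)
      ≤ ‖a‖ * ‖W b₁ + b₃‖ + ‖b₁‖ * ‖a + b₂‖ + ‖b₂‖ * ‖b₁ + b₃‖ + ‖b₃‖ * ‖b₂ + W a‖ := by
    rw [h2S, ← W.norm_map a]
    linarith [re_inner_le_norm (𝕜 := 𝕜) (W a) (W b₁ + b₃), re_inner_le_norm (𝕜 := 𝕜) b₁ (a + b₂), re_inner_le_norm (𝕜 := 𝕜) b₂ (b₁ + b₃),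
      re_inner_le_norm (𝕜 := 𝕜) b₃ (b₂ + W a)]
  have hle' : -(2 * (RCLike.re ⟪a, b₁⟫_𝕜 + RCLike.re ⟪b₁, b₂⟫_𝕜 + RCLike.re ⟪b₂, b₃⟫_𝕜 + RCLike.re ⟪b₃, W a⟫_𝕜))
      ≤ ‖a‖ * ‖W b₁ + b₃‖ + ‖b₁‖ * ‖a + b₂‖ + ‖b₂‖ * ‖b₁ + b₃‖ + ‖b₃‖ * ‖b₂ + W a‖ := by
    rw [h2S, ← W.norm_map a]
    have i0 := re_inner_le_norm (𝕜 := 𝕜) (W a) (-(W b₁ + b₃))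
    have i1 := re_inner_le_norm (𝕜 := 𝕜) b₁ (-(a + b₂))
    have i2 := re_inner_le_norm (𝕜 := 𝕜) b₂ (-(b₁ + b₃))
    have i3 := re_inner_le_norm (𝕜 := 𝕜) b₃ (-(b₂ + W a))
    rw [inner_neg_right, map_neg, norm_neg] at i0 i1 i2 i3
    linarith
  have hCS : (2 * (RCLike.re ⟪a, b₁⟫_𝕜 + RCLike.re ⟪b₁, b₂⟫_𝕜 + RCLike.re ⟪b₂, b₃⟫_𝕜 + RCLike.re ⟪b₃, W a⟫_𝕜)) ^ 2
      ≤ (‖a‖ ^ 2 + ‖b₁‖ ^ 2 + ‖b₂‖ ^ 2 + ‖b₃‖ ^ 2) * (‖W b₁ + b₃‖ ^ 2 + ‖a + b₂‖ ^ 2 + ‖b₁ + b₃‖ ^ 2 + ‖b₂ + W a‖ ^ 2) := by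
    have hsq := sq_le_sq' (by linarith [hle']) hle
    exact hsq.trans hcs
  -- `U = 2N + 2T`, `T ≤ ρ N/2`
  have hUeq : ‖W b₁ + b₃‖ ^ 2 + ‖a + b₂‖ ^ 2 + ‖b₁ + b₃‖ ^ 2 + ‖b₂ + W a‖ ^ 2
      = 2 * (‖a‖ ^ 2 + ‖b₁‖ ^ 2 + ‖b₂‖ ^ 2 + ‖b₃‖ ^ 2) + 2 * (RCLike.re ⟪b₁ + W b₁, b₃⟫_𝕜 + RCLike.re ⟪b₂, a + W a⟫_𝕜) := by
    rw [@norm_add_sq 𝕜, @norm_add_sq 𝕜, @norm_add_sq 𝕜, @norm_add_sq 𝕜, W.norm_map, W.norm_map, inner_add_left, inner_add_right, map_add, map_add, e5]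
    ring
  have hT : RCLike.re ⟪b₁ + W b₁, b₃⟫_𝕜 + RCLike.re ⟪b₂, a + W a⟫_𝕜 ≤ Real.sqrt (2 + 2 * γ) * ((‖a‖ ^ 2 + ‖b₁‖ ^ 2 + ‖b₂‖ ^ 2 + ‖b₃‖ ^ 2) / 2) := by
    have t1 : RCLike.re ⟪b₁ + W b₁, b₃⟫_𝕜 ≤ Real.sqrt (2 + 2 * γ) * ‖b₁‖ * ‖b₃‖ := by
      calc RCLike.re ⟪b₁ + W b₁, b₃⟫_𝕜 ≤ ‖b₁ + W b₁‖ * ‖b₃‖ := re_inner_le_norm _ _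
        _ ≤ (Real.sqrt (2 + 2 * γ) * ‖b₁‖) * ‖b₃‖ := mul_le_mul_of_nonneg_right (norm_add_isometry_le W hγ b₁) (norm_nonneg _)
        _ = Real.sqrt (2 + 2 * γ) * ‖b₁‖ * ‖b₃‖ := by ring
    have t2 : RCLike.re ⟪b₂, a + W a⟫_𝕜 ≤ Real.sqrt (2 + 2 * γ) * ‖b₂‖ * ‖a‖ := by
      calc RCLike.re ⟪b₂, a + W a⟫_𝕜 ≤ ‖b₂‖ * ‖a + W a‖ := re_inner_le_norm _ _
        _ ≤ ‖b₂‖ * (Real.sqrt (2 + 2 * γ) * ‖a‖) := mul_le_mul_of_nonneg_left (norm_add_isometry_le W hγ a) (norm_nonneg _)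
        _ = Real.sqrt (2 + 2 * γ) * ‖b₂‖ * ‖a‖ := by ring
    have amgm : ‖b₁‖ * ‖b₃‖ + ‖b₂‖ * ‖a‖ ≤ (‖a‖ ^ 2 + ‖b₁‖ ^ 2 + ‖b₂‖ ^ 2 + ‖b₃‖ ^ 2) / 2 := by
      nlinarith [sq_nonneg (‖b₁‖ - ‖b₃‖), sq_nonneg (‖b₂‖ - ‖a‖)]
    have t3 : Real.sqrt (2 + 2 * γ) * (‖b₁‖ * ‖b₃‖ + ‖b₂‖ * ‖a‖) ≤ Real.sqrt (2 + 2 * γ) * ((‖a‖ ^ 2 + ‖b₁‖ ^ 2 + ‖b₂‖ ^ 2 + ‖b₃‖ ^ 2) / 2) :=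
      mul_le_mul_of_nonneg_left amgm hρ0
    linarith
  -- conclude with plain real arithmetic (no abbreviations)
  have hUle : ‖W b₁ + b₃‖ ^ 2 + ‖a + b₂‖ ^ 2 + ‖b₁ + b₃‖ ^ 2 + ‖b₂ + W a‖ ^ 2
      ≤ (2 + Real.sqrt (2 + 2 * γ)) * (‖a‖ ^ 2 + ‖b₁‖ ^ 2 + ‖b₂‖ ^ 2 + ‖b₃‖ ^ 2) := by
    rw [hUeq, add_mul]; linarith [hT]
  have h2ρ : 0 ≤ 2 + Real.sqrt (2 + 2 * γ) := by linarith
  have hSS : (2 * (RCLike.re ⟪a, b₁⟫_𝕜 + RCLike.re ⟪b₁, b₂⟫_𝕜 + RCLike.re ⟪b₂, b₃⟫_𝕜 + RCLike.re ⟪b₃, W a⟫_𝕜)) ^ 2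
      ≤ (Real.sqrt (2 + Real.sqrt (2 + 2 * γ)) * (‖a‖ ^ 2 + ‖b₁‖ ^ 2 + ‖b₂‖ ^ 2 + ‖b₃‖ ^ 2)) ^ 2 := by
    conv_rhs => rw [mul_pow, Real.sq_sqrt h2ρ]
    calc (2 * (RCLike.re ⟪a, b₁⟫_𝕜 + RCLike.re ⟪b₁, b₂⟫_𝕜 + RCLike.re ⟪b₂, b₃⟫_𝕜 + RCLike.re ⟪b₃, W a⟫_𝕜)) ^ 2
        ≤ (‖a‖ ^ 2 + ‖b₁‖ ^ 2 + ‖b₂‖ ^ 2 + ‖b₃‖ ^ 2) * (‖W b₁ + b₃‖ ^ 2 + ‖a + b₂‖ ^ 2 + ‖b₁ + b₃‖ ^ 2 + ‖b₂ + W a‖ ^ 2) := hCS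
      _ ≤ (‖a‖ ^ 2 + ‖b₁‖ ^ 2 + ‖b₂‖ ^ 2 + ‖b₃‖ ^ 2) * ((2 + Real.sqrt (2 + 2 * γ)) * (‖a‖ ^ 2 + ‖b₁‖ ^ 2 + ‖b₂‖ ^ 2 + ‖b₃‖ ^ 2)) :=
          mul_le_mul_of_nonneg_left hUle hN0
      _ = (2 + Real.sqrt (2 + 2 * γ)) * (‖a‖ ^ 2 + ‖b₁‖ ^ 2 + ‖b₂‖ ^ 2 + ‖b₃‖ ^ 2) ^ 2 := by ring
  have h2Sle : 2 * (RCLike.re ⟪a, b₁⟫_𝕜 + RCLike.re ⟪b₁, b₂⟫_𝕜 + RCLike.re ⟪b₂, b₃⟫_𝕜 + RCLike.re ⟪b₃, W a⟫_𝕜)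
      ≤ Real.sqrt (2 + Real.sqrt (2 + 2 * γ)) * (‖a‖ ^ 2 + ‖b₁‖ ^ 2 + ‖b₂‖ ^ 2 + ‖b₃‖ ^ 2) :=
    (abs_le_of_sq_le_sq' hSS (mul_nonneg (Real.sqrt_nonneg _) hN0)).2
  rw [hF, plaqGap, sub_mul]
  linarith [h2Sle]

/-- The isometry of `E` induced by a map preserving norms (bookkeeping for products of links). [folklore] -/
theorem comp_norm_map (W₁ W₂ : E →ₗᵢ[𝕜] E) (u : E) : ‖(W₁.comp W₂) u‖ = ‖u‖ := (W₁.comp W₂).norm_map u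

/-- ★★ **THE TWISTED 4-CYCLE LEMMA FOR FOUR LINKS**: for linear isometries `W₀₁, W₁₂, W₂₃, W₃₀` (the transporters around a plaquette) whose holonomy `W = W₀₁W₁₂W₂₃W₃₀` satisfies
`Re⟪u, Wu⟫ ≤ γ‖u‖²`: `λ(γ)·(‖a₀‖²+‖a₁‖²+‖a₂‖²+‖a₃‖²) ≤ ‖a₀−W₀₁a₁‖² + ‖a₁−W₁₂a₂‖² + ‖a₂−W₂₃a₃‖² + ‖a₃−W₃₀a₀‖²` (gauge-fix `b₁ = W₀₁a₁`, `b₂ = W₀₁W₁₂a₂`, `b₃ = W₀₁W₁₂W₂₃a₃`;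
isometries preserve every norm involved). [cite: DodziukMathai2006, Cor 1.3 §1; Balaban1985BackgroundPropagators, (3.23) p.394] -/
theorem twisted_cycle_four_ge_links (W₀₁ W₁₂ W₂₃ W₃₀ : E →ₗᵢ[𝕜] E) {γ : ℝ}
    (hγ : ∀ u, RCLike.re ⟪u, (W₀₁.comp (W₁₂.comp (W₂₃.comp W₃₀))) u⟫_𝕜 ≤ γ * ‖u‖ ^ 2) (a₀ a₁ a₂ a₃ : E) :
    plaqGap γ * (‖a₀‖ ^ 2 + ‖a₁‖ ^ 2 + ‖a₂‖ ^ 2 + ‖a₃‖ ^ 2)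
      ≤ ‖a₀ - W₀₁ a₁‖ ^ 2 + ‖a₁ - W₁₂ a₂‖ ^ 2 + ‖a₂ - W₂₃ a₃‖ ^ 2 + ‖a₃ - W₃₀ a₀‖ ^ 2 := by
  have h := twisted_cycle_four_ge (W₀₁.comp (W₁₂.comp (W₂₃.comp W₃₀))) hγ a₀ (W₀₁ a₁) (W₀₁ (W₁₂ a₂)) (W₀₁ (W₁₂ (W₂₃ a₃)))
  have n1 : ‖W₀₁ a₁‖ = ‖a₁‖ := W₀₁.norm_map a₁
  have n2 : ‖W₀₁ (W₁₂ a₂)‖ = ‖a₂‖ := by rw [W₀₁.norm_map, W₁₂.norm_map]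
  have n3 : ‖W₀₁ (W₁₂ (W₂₃ a₃))‖ = ‖a₃‖ := by rw [W₀₁.norm_map, W₁₂.norm_map, W₂₃.norm_map]
  have d1 : ‖W₀₁ a₁ - W₀₁ (W₁₂ a₂)‖ = ‖a₁ - W₁₂ a₂‖ := by rw [← map_sub, W₀₁.norm_map]
  have d2 : ‖W₀₁ (W₁₂ a₂) - W₀₁ (W₁₂ (W₂₃ a₃))‖ = ‖a₂ - W₂₃ a₃‖ := by rw [← map_sub, ← map_sub, W₀₁.norm_map, W₁₂.norm_map]
  have d3 : ‖W₀₁ (W₁₂ (W₂₃ a₃)) - (W₀₁.comp (W₁₂.comp (W₂₃.comp W₃₀))) a₀‖ = ‖a₃ - W₃₀ a₀‖ := by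
    simp only [LinearIsometry.coe_comp, Function.comp_apply]
    rw [← map_sub, ← map_sub, ← map_sub, W₀₁.norm_map, W₁₂.norm_map, W₂₃.norm_map]
  rw [n1, n2, n3, d1, d2, d3] at h
  exact h

end Cycle

/-! ## §3 The scalar (`U(1)`) reading of the hypothesis -/

section Scalar

variable {𝕜 : Type*} [RCLike 𝕜] {E : Type*} [NormedAddCommGroup E] [InnerProductSpace 𝕜 E]

/-- For a scalar holonomy `W = w·1` (`U(1)` links): `Re⟪u, w•u⟫ = Re w·‖u‖²`, so the numerical-range hypothesis holds with `γ = Re w` (`= cos θ` for `w = e^{iθ}`), with EQUALITY. [folklore] -/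
theorem re_inner_smul_self (w : 𝕜) (u : E) : RCLike.re ⟪u, w • u⟫_𝕜 = RCLike.re w * ‖u‖ ^ 2 := by
  rw [inner_smul_right, inner_self_eq_norm_sq_to_K]
  rw [show (w * ((‖u‖ : 𝕜) ^ 2)) = w * (((‖u‖ ^ 2 : ℝ) : 𝕜)) by push_cast; ring, RCLike.re_mul_ofReal]

/-- Multiplication by a unit scalar as a linear isometry of `E`. [folklore] -/
def smulIsometry (w : 𝕜) (hw : ‖w‖ = 1) : E →ₗᵢ[𝕜] E where
  toLinearMap := w • LinearMap.id
  norm_map' := fun u => by simp [norm_smul, hw]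

omit [InnerProductSpace 𝕜 E] in
/-- `smulIsometry w u = w • u`. [folklore] -/
@[simp] theorem smulIsometry_apply [InnerProductSpace 𝕜 E] (w : 𝕜) (hw : ‖w‖ = 1) (u : E) : smulIsometry w hw u = w • u := rfl

/-- ★ THE SCALAR 4-CYCLE: for a unit scalar holonomy `w`, `λ(Re w)·Σ‖a_i‖² ≤ ‖a−b₁‖²+‖b₁−b₂‖²+‖b₂−b₃‖²+‖b₃−w•a‖²` (for `w = e^{iθ}`, `|θ| ≤ π`: `λ = 2 − 2cos(θ∕4)` by `plaqGap_cos`).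
[cite: DodziukMathai2006, Cor 1.3 §1] -/
theorem twisted_cycle_four_ge_scalar {w : 𝕜} (hw : ‖w‖ = 1) (a b₁ b₂ b₃ : E) :
    plaqGap (RCLike.re w) * (‖a‖ ^ 2 + ‖b₁‖ ^ 2 + ‖b₂‖ ^ 2 + ‖b₃‖ ^ 2)
      ≤ ‖a - b₁‖ ^ 2 + ‖b₁ - b₂‖ ^ 2 + ‖b₂ - b₃‖ ^ 2 + ‖b₃ - w • a‖ ^ 2 := by
  have h := twisted_cycle_four_ge (smulIsometry (E := E) w hw) (γ := RCLike.re w) (fun u => by rw [smulIsometry_apply, re_inner_smul_self]) a b₁ b₂ b₃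
  rwa [smulIsometry_apply] at h

end Scalar

end Summit.QuantumFields.YangMills.BalabanUVNodes.N15KingModelRung.Curvature

end
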